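import Mathlib
import HarnessLib
import HarnessLib.Audit
import Summits.AtomisticToContinuum.Statement
import Literature.MathematicalPhysics.QuantumManyBody.PeriodicBoseGas

/-!
Route: BECPeriodicReduction

CLOSED (retired) 2026-08-15T13:39:25Z by operator:999:1257524 — reason: not-a-thesis: assembly does not conclude the sub-problem Statement — note: D-0027 §2.1 audit (human 2026-08-15: routes that do not decide the summit are removed): the assembly concludes `Literature.MathematicalPhysics.QuantumManyBody.BoseGas.BoseEinsteinCondensation`, not the sub-problem statement; a NEW conforming route may be opened from the same idea (generated `closes . The file is kept as the record of this route; refuted decls are indexed as negative knowledge (`ledger negatives`).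

X_G (PERIODIC REDUCTION; formal). It suffices to show PeriodicBEC ∧ BoundaryTransferWeak, where
(i) PeriodicBEC — constant-mode Bose–Einstein condensation for near-minimisers of the PERIODIC
N-body energy on the torus
    of side L = (N/ρ)^{1/3} at all small densities: for every repulsive finite-range radial v there
is ρ₀ > 0 such that
    for 0 < ρ < ρ₀ there is c > 0 with: for all large N there is δ > 0 such that every periodic
trial state Ψ with
    periodicEnergy v Ψ ≤ E₀^per(N,L) + δ has ⟨Ψ, n₀ Ψ⟩ = condensateOccupation N L Ψ ≥ c·N
(Fournais's n₀ = Σ_j P_{Ω,j});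
(ii) BoundaryTransferWeak — for each such v, PeriodicBEC(v) implies the conjunct's Dirichlet,
mode-free criterion
    HasGroundStateBEC v ρ (λ_max of γ of the Dirichlet ground state ≥ cN, L = (N/ρ)^{1/3}) for all
small ρ.
Lean (rc 0 in Sketch.lean; every constant exists: Literature.BoseGas.{IsRepulsiveFiniteRange,
PeriodicTrialState, periodicEnergy,
periodicGroundStateEnergy, condensateOccupation, sideLength, HasGroundStateBEC,
BoseEinsteinCondensation}):
PeriodicBEC := ∀ v : ℝ → ENNReal,
Literature.MathematicalPhysics.QuantumManyBody.BoseGas.IsRepulsiveFiniteRange v → ∃ ρ₀ : ℝ, 0 < ρ₀ ∧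
∀ ρ : ℝ, 0 < ρ → ρ < ρ₀ → ∃ c : ℝ, 0 < c ∧ ∀ᶠ N : ℕ in Filter.atTop, ∃ δ : ENNReal, 0 < δ ∧ ∀ Ψ :
Literature.MathematicalPhysics.QuantumManyBody.BoseGas.PeriodicTrialState N
(Literature.MathematicalPhysics.QuantumManyBody.BoseGas.sideLength ρ N),
Literature.MathematicalPhysics.QuantumManyBody.BoseGas.periodicEnergy v Ψ ≤
Literature.MathematicalPhysics.QuantumManyBody.BoseGas.periodicGroundStateEnergy v N
(Literature.MathematicalPhysics.QuantumManyBody.BoseGas.sideLength ρ N) + δ → ENNReal.ofReal (c * N)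
≤ Literature.MathematicalPhysics.QuantumManyBody.BoseGas.condensateOccupation N
(Literature.MathematicalPhysics.QuantumManyBody.BoseGas.sideLength ρ N) Ψ.ψ
BoundaryTransferWeak := ∀ v, IsRepulsiveFiniteRange v → ⟨PeriodicBEC body for v⟩ → ∃ ρ₀ > 0, ∀ ρ ∈
(0,ρ₀), Literature.MathematicalPhysics.QuantumManyBody.BoseGas.HasGroundStateBEC v ρ
Assembly := PeriodicBEC → BoundaryTransferWeak →
Literature.MathematicalPhysics.QuantumManyBody.BoseGas.BoseEinsteinCondensation (term-mode glue: fun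
h1 h2 v hv => h2 v hv (h1 v hv)).

Rationale: WHY THIS LINE. Every rigorous advance on condensation in the dilute gas since 2018 is proved on the
TORUS or in NEUMANN boxes,
where translation invariance makes the condensate wave function the constant: Fournais2020 (Thm 1.2,
periodic, scales
(ρa)^{-1/2}(ρa³)^{-δ}), AdhikariBrenneckeSchlein2020 and BrenneckeEtAl2024 (GP regime and beyond,
periodic),
FournaisEtAl2024 (Thm 1.3, Neumann boxes) and Junge2026 (Cor. 6: Neumann, R ~ a(ρa³)^{-3/4-η}),
ChongLiangNam2026.
The audited conjunct is DIRICHLET and mode-free (λ_max of γ via condensateNumber). Refuters of route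
BECInfraredBound
showed (items 0733/0735 notes) that Dirichlet near-minimisers do NOT have Bogoliubov-shaped
plane-wave occupations
(free gas: φ₀-fraction (8/π²)³ ≈ 0.53; interacting: healing-length boundary layer), so cruxes typed
directly on the
Dirichlet box with the constant mode carry artefacts. This route separates the two difficulties:
PeriodicBEC is the open
problem in the literature's own setting (all named facts of PeriodicBoseGas.lean bear on it
verbatim), and the
boundary-condition transfer is isolated as its own crux — for the ENERGY the transfer is classical
(LSSY2005 Ch. 2,
after (2.8); Robinson), for the CONDENSATE FRACTION nothing is in print (grounder g4-0 / refuter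
g26-3 on item 0695).
No other area is imported here on purpose: this is the reformulation route that the method routes
(BECScaleInduction,
BECFeynmanKacCycles, BECPinning's periodic crux, BECRenormGroup's 0695) plug into; its items are
shared by signature.
RANKED CRUXES.
 2. PeriodicBEC [crux, formal] — the heart; any method.
 3. BoundaryTransferWeak [crux, formal] — PeriodicBEC(v) ⇒ HasGroundStateBEC v ρ (ρ small). Not
glue: near-minimiser
    slacks are O(N/L²) = O(N^{1/3}) (a phase twist e^{i2πΣx_i/L} costs N(2π/L)² and empties the
constant mode), while
    Dirichlet-vs-periodic ground-state energies differ by a boundary term ≫ N^{1/3}; so the transfer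
cannot go through
    energy comparison and must be structural (Neumann bracketing of interior sub-boxes goes the
right way:
    −Δ_Dir ≥ ⊕ −Δ_Neu, v ≥ 0 drops cross terms; then a mode-free criterion such as λ_max(γ) ≥
tr(γ²)/N).
 4. BoundaryTransfer [crux, formal] — the STRONG form filed verbatim from refuter g26-3's rc0 split
of 0695:
    PeriodicBEC(v) ⇒ X_B1(v) (Dirichlet constant-mode occupation ≥ cN, item 0686's body). Implies
rank 3 via
    occupation_le_maxOccupation + le_condensateNumber (theorem bec_of_zeroMode pattern).
 1. Assembly [formal, trivial].
KILL CRITERIA. A proof of ¬PeriodicBEC for some admissible v at arbitrarily small ρ kills this route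
AND routes
BECScaleInduction/BECFeynmanKacCycles (and, physically, the conjunct). A proof of ¬BoundaryTransfer
(strong) does not
kill the route (rank 3 is mode-free); ¬BoundaryTransferWeak would mean Dirichlet walls destroy an
existing torus
condensate — kills the route, not the conjunct.
DEGENERATE CASES CHECKED. v ≡ 0 (admissible, a = 0): PeriodicBEC(0) true (constant is the periodic
ground state, gap
(2π/L)², take δ < gap); conclusion true (Dirichlet free gas, λ_max = N). periodicGroundStateEnergy =
⊤ would make the
hypothesis of PeriodicBEC vacuous and its conclusion false, so provers must show finiteness at low
density (hard cores:
ρ < R₀⁻³ suffices) — intended.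
NOT DECOMPOSED. How to prove PeriodicBEC (see the method routes); ensemble questions (canonical only
here); T > 0.
SOURCES. LiebSeiringerSolovejYngvason2005 §1.2, Ch. 2, Ch. 5; Fournais2020; FournaisSolovej2020;
FournaisEtAl2024;
Junge2026 (arXiv:2603.20776); ChongLiangNam2026 (arXiv:2510.20493); BrenneckeEtAl2024;
AdhikariBrenneckeSchlein2020.

Novelty: NOVELTY (retriage planner, 2026-08-14). Searches run BEFORE this claim: `lit frontier
AtomisticToContinuum --since 2020` (BEC descendants: arXiv:2603.20776 Junge2026, arXiv:2510.20493
ChongLiangNam2026, arXiv:2602.16566); `lit bridges AtomisticToContinuum --cross any` (no Bose-gas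
bridge); `lit search` local + Crossref ("attractive boundary conditions Bose condensation Robinson";
"Bose gas box Dirichlet boundary conditions Gross-Pitaevskii condensation"; OpenAlex/S2/arXiv were
HTTP 429 in this pass); `lit search --hybrid` x2 and `lit vsearch` x2 (boundary-condition dependence
of BEC / condensate fraction; only textbooks surface); `lit galaxy search --star pdf` (substring x2:
0 hits; --mode intelligent x1: physics BEC papers only, nothing closer); `lit read` arXiv:2603.20776
pp.1,4-6; arXiv:2510.20493 pp.2-3,12; arXiv:2203.01841 p.3; arXiv:2205.15284 pp.1-3;
arXiv:math-ph/0205037 pp.3-4; LSSY2005 pp.13-14,35-36 (grounder reground quotes).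
Nearest prior art actually FOUND:
(i) Boundary-condition transfer is classical for the ENERGY only: LiebSeiringerSolovejYngvason2005
Ch.2 after (2.2)/(2.8) (Neumann for lower, Dirichlet for upper bounds; e_0(rho) independent of BC);
Basti2022 = arXiv:2203.01841 p.3 ("following a well known localization procedure (see [R] = Robinson
1971) this [periodic] trial state can then be easily modified to provide a trial state with the
correct energy on a larger box with Dirichlet boundary conditions. The latter can finally be
replicated to recover the  [refs: 10.1007/bf01608554, 2603.20776, 2510.20493, 2602.16566, 2203.01841, 2205.15284, math-ph/0205037, doi:10.1007/bf01608554, Junge2026, ChongLiangNam2026, LSSY2005, LiebSeiringerSolovejYngvason2005, Basti2022, BoccatoSeiringer2023, Fournais2020, LauwersVerbeureZagrebnov2003, Robinson1976]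

Barriers (technique_class: periodic-reformulation; BC-transfer; Neumann-bracketing): BARRIERS (catalogue Literature/Barriers/AtomisticToContinuum; the BEC entries read 2026-08-14; decls
in namespace Literature.Barriers.AtomisticToContinuum; one line per fact: applies / evaded / honest
non-evasion).
KineticGapLengthScales (= Literature.Barriers.AtomisticToContinuum.BoseGas.LSSY2005_thm51_periodic):
APPLIES squarely to crux PeriodicBEC - every gap-based energy-localization proof (LSSY2005 Thm 5.1,
Fournais2020 Thm 1.2, Junge2026 Cor. 6, ChongLiangNam2026) controls the depletion by (box side)^2 x
(excess energy per particle) and stops at L <~ a(rho a^3)^{-3/4-eta}, never the thermodynamic L =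
(N/rho)^{1/3}. NOT evaded: PeriodicBEC is filed as the open heart ("any method"); the bet is that a
gap-free mechanism from the method routes lands first on the torus, where translation invariance
fixes the condensate wave function to the constant. It also shadows the transfer cruxes: a transfer
that re-localizes the Dirichlet ground state into sub-boxes of side l << L re-imports the l^{-2} gap
bookkeeping; BoundaryTransferWeak/BoundaryTransfer leave the blocked class only insofar as they
consume the thermodynamic-scale hypothesis PeriodicBEC as a black box - whether that is possible is
exactly what ranks 3-4 ask (see their why_might_fail).
EnergyAsymptoticsWithoutCondensation (= LiebLiniger_bogoliubovTwoOrders): APPLIES to any attempt to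
get PeriodicBEC or the transfers from LHY-precision energy information alone (energy asymptotics
neither assume nor imply BEC; 1D Lieb-Li

History (route lifecycle, newest last):
- 2026-08-15T13:39:25Z · CLOSED retired — not-a-thesis: assembly does not conclude the sub-problem Statement (operator:999:1257524)

sub-problem: BoseEinsteinCondensation · status: closed(retired) · opened planner-plan-AtomisticToContinuum-BoseEinsteinCondensation-0 2026-08-13T19:14:43Z · rev 1 · ledger route-AtomisticToContinuum-BECPeriodicReduction
GENERATED by the gate from the ledger (D-0016/17). Provers cite these decls: `theorem foo : Summit.AtomisticToContinuum.BoseEinsteinCondensation.Theses.BECPeriodicReduction.<Decl> := …` in Summits/AtomisticToContinuum/BoseEinsteinCondensation/Theorems/<Name>.lean.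
-/

namespace Summit.AtomisticToContinuum.BoseEinsteinCondensation.Theses.BECPeriodicReduction

open scoped BigOperators Topology Manifold Classical MeasureTheory ProbabilityTheory Matrix InnerProductSpace ComplexConjugate ContinuousMap
open Filter Set Function TopologicalSpace MeasureTheory

attribute [summit_statement] _root_.BoseEinsteinCondensation

/-- item stmt-AtomisticToContinuum-0826 · crux · rank 2 · closed · moot by None · by planner
why it might fail: Box L=(N/ρ)^{1/3}→∞ at fixed ρ: every printed bound on n₊ pays the inverse kinetic gap L², so it is o(N) only up to L≲a(ρa³)^{-3/4-η} (Fournais2020 Thm 1.2; Junge2026 Cor 6); T=0 Bogoliubov expansions diverge in d=3; hard cores v=⊤ are admissible and c must be uniform in N.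
sources: LiebSeiringerSolovejYngvason2005 Ch.5 §5.1 (5.2), p.35 'open after 75 years', Fournais2020 = arXiv:2011.00309 Thm 1.2 and §1 after (1.12), Junge2026 = arXiv:2603.20776 Thm 4, Cor 6, p.5 'not able to prove BEC in the thermodynamic limit', ChongLiangNam2026 = arXiv:2510.20493 p.2, Literature.Barriers.AtomisticToContinuum.KineticGapLengthScales, Literature.Barriers.AtomisticToContinuum.BogoliubovPerturbationInfrared
[crux] PeriodicBEC: for every repulsive finite-range radial v there is ρ₀>0 such that for 0<ρ<ρ₀
there is c>0 with: for all large N there is δ>0 such that every PERIODIC trial state Ψ on the torus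
of side L=(N/ρ)^{1/3} with periodicEnergy ≤ E₀^per(N,L)+δ has constant-mode occupation ⟨Ψ,n₀Ψ⟩ =
condensateOccupation N L Ψ ≥ cN. The open problem in the literature's own (translation-invariant)
setting; Fournais2020 Thm 1.2 gives it on scales L ≤ C(ρa³)^{-δ}(ρa)^{-1/2}, Junge2026 Cor. 6
(Neumann) up to a(ρa³)^{-3/4-η}. Sources: LiebSeiringerSolovejYngvason2005 Ch. 5; Fournais2020;
Junge2026; ChongLiangNam2026. -/
@[route_item "route-AtomisticToContinuum-BECPeriodicReduction"]
def PeriodicBEC : Prop :=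
  ∀ v : ℝ → ENNReal, Literature.MathematicalPhysics.QuantumManyBody.BoseGas.IsRepulsiveFiniteRange v → ∃ ρ₀ : ℝ, 0 < ρ₀ ∧ ∀ ρ : ℝ, 0 < ρ → ρ < ρ₀ → ∃ c : ℝ, 0 < c ∧ ∀ᶠ N : ℕ in Filter.atTop, ∃ δ : ENNReal, 0 < δ ∧ ∀ Ψ : Literature.MathematicalPhysics.QuantumManyBody.BoseGas.PeriodicTrialState N (Literature.MathematicalPhysics.QuantumManyBody.BoseGas.sideLength ρ N), Literature.MathematicalPhysics.QuantumManyBody.BoseGas.periodicEnergy v Ψ ≤ Literature.MathematicalPhysics.QuantumManyBody.BoseGas.periodicGroundStateEnergy v N (Literature.MathematicalPhysics.QuantumManyBody.BoseGas.sideLength ρ N) + δ → ENNReal.ofReal (c * N) ≤ Literature.MathematicalPhysics.QuantumManyBody.BoseGas.condensateOccupation N (Literature.MathematicalPhysics.QuantumManyBody.BoseGas.sideLength ρ N) Ψ.ψ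

/-- item stmt-AtomisticToContinuum-0827 · crux · rank 3 · open · by planner
why it might fail: PeriodicBEC(v) is ground-state-only (δ after N) at the box (N/ρ)^{1/3}: the Dirichlet GS is a periodic trial state but lies a wall term ≫δ above E₀^per; interior restrictions are neither periodic nor of sharp N, so the hypothesis may never fire (transfer≈conjunct). BEC is BC-sensitive: Robinson1976.
sources: LiebSeiringerSolovejYngvason2005 Ch.2 after (2.2) and after (2.8) (energy BC-independent only); Thm 5.1 remark p.36 (Dirichlet excluded, 'treated with the methods of Ch. 7'), Basti2022 = arXiv:2203.01841 p.3 (periodic→Dirichlet→thermodynamic box is a 'well known localization procedure' for the ENERGY only), BoccatoSeiringer2023 = arXiv:2205.15284 pp.1-2 (Dirichlet for upper, Neumann for lower bounds; Neumann bracketing), Junge2026 = arXiv:2603.20776 Thm 3 p.4 (nearest printed structural tool: Neumann localization inequality), Robinson1976 = doi:10.1007/bf01608554, LauwersVerbeureZagrebnov2003 = arXiv:math-ph/0205037 pp.3-4 (gap from attractive BC gives BEC in all D≥1)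
[crux] BoundaryTransferWeak (mode-free boundary-condition transfer, per potential): for each
repulsive finite-range v, PeriodicBEC(v) implies ∃ρ₀>0 ∀ρ∈(0,ρ₀) HasGroundStateBEC v ρ (Dirichlet
ground state, λ_max(γ) ≥ cN via condensateNumber). Not glue: near-minimiser slacks are O(N/L²) while
Dirichlet/periodic energies differ by a boundary term ≫ N/L², so no energy-comparison proof;
expected route: Neumann bracketing of interior sub-boxes (−Δ_Dir ≥ ⊕−Δ_Neu, v ≥ 0) + a mode-free
criterion (λ_max ≥ tr γ²/N). Only the ENERGY analogue is in print (LiebSeiringerSolovejYngvason2005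
Ch. 2 after (2.8)). v ≡ 0: hypothesis and conclusion both true. -/
@[route_item "route-AtomisticToContinuum-BECPeriodicReduction"]
def BoundaryTransferWeak : Prop :=
  ∀ v : ℝ → ENNReal, Literature.MathematicalPhysics.QuantumManyBody.BoseGas.IsRepulsiveFiniteRange v → (∃ ρ₀ : ℝ, 0 < ρ₀ ∧ ∀ ρ : ℝ, 0 < ρ → ρ < ρ₀ → ∃ c : ℝ, 0 < c ∧ ∀ᶠ N : ℕ in Filter.atTop, ∃ δ : ENNReal, 0 < δ ∧ ∀ Ψ : Literature.MathematicalPhysics.QuantumManyBody.BoseGas.PeriodicTrialState N (Literature.MathematicalPhysics.QuantumManyBody.BoseGas.sideLength ρ N), Literature.MathematicalPhysics.QuantumManyBody.BoseGas.periodicEnergy v Ψ ≤ Literature.MathematicalPhysics.QuantumManyBody.BoseGas.periodicGroundStateEnergy v N (Literature.MathematicalPhysics.QuantumManyBody.BoseGas.sideLength ρ N) + δ → ENNReal.ofReal (c * N) ≤ Literature.MathematicalPhysics.QuantumManyBody.BoseGas.condensateOccupation N (Literature.MathematicalPhysics.QuantumManyBody.BoseGas.sideLength ρ N) Ψ.ψ)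 → ∃ ρ₀ : ℝ, 0 < ρ₀ ∧ ∀ ρ : ℝ, 0 < ρ → ρ < ρ₀ → Literature.MathematicalPhysics.QuantumManyBody.BoseGas.HasGroundStateBEC v ρ

/-- item stmt-AtomisticToContinuum-0828 · crux · rank 4 · closed · moot by None · by planner
why it might fail: BoundaryTransferWeak's obstruction plus a mode commitment: the Dirichlet condensate wave function is a GP-type profile with a healing-length wall layer, not L^{-3/2}1_box (free gas: constant-mode share (8/π²)³≈0.53; refuter notes on 0689/0733), so c must absorb BC artefacts uniformly in N.
sources: LiebSeiringerSolovejYngvason2005 Thm 5.1 remark p.36 + Ch.7 (Dirichlet/trap: condensation into the GP minimiser, LiebSeiringer2002), refuter g2-4 / g26-3 notes on stmt-AtomisticToContinuum-0689, -0733, -0695 (Dirichlet boundary layer; (8/π²)³ free-gas constant-mode fraction), BoccatoSeiringer2023 = arXiv:2205.15284 p.3 (Neumann box: condensate/correlation structure differs from the periodic case), Robinson1976 = doi:10.1007/bf01608554, in-tree glue 0828⇒0827: Literature.MathematicalPhysics.QuantumManyBody.BoseGas.occupation_le_maxOccupation, Literature.MathematicalPhysics.QuantumManyBody.BoseGas.le_condensateNumber,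 AtomisticToContinuum.BECInfraredBound.bec_of_zeroMode
[crux] BoundaryTransfer (strong, constant-mode form; verbatim the rc0 split signature proposed by
refuter g26-3 on item stmt-AtomisticToContinuum-0695): for each repulsive finite-range v,
PeriodicBEC(v) implies X_B1(v) — occupation ≥ cN of the normalised constant mode L^{-3/2}1_box for
δ-near-minimisers of the DIRICHLET energy (item 0686 body). Implies BoundaryTransferWeak by
occupation_le_maxOccupation + le_condensateNumber (pattern of theorem
AtomisticToContinuum.BECInfraredBound.bec_of_zeroMode). v ≡ 0: conclusion holds with c < (8/π²)³. -/
@[route_item "route-AtomisticToContinuum-BECPeriodicReduction"]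
def BoundaryTransfer : Prop :=
  ∀ v : ℝ → ENNReal, Literature.MathematicalPhysics.QuantumManyBody.BoseGas.IsRepulsiveFiniteRange v → (∃ ρ₀ : ℝ, 0 < ρ₀ ∧ ∀ ρ : ℝ, 0 < ρ → ρ < ρ₀ → ∃ c : ℝ, 0 < c ∧ ∀ᶠ N : ℕ in Filter.atTop, ∃ δ : ENNReal, 0 < δ ∧ ∀ Ψ : Literature.MathematicalPhysics.QuantumManyBody.BoseGas.PeriodicTrialState N (Literature.MathematicalPhysics.QuantumManyBody.BoseGas.sideLength ρ N), Literature.MathematicalPhysics.QuantumManyBody.BoseGas.periodicEnergy v Ψ ≤ Literature.MathematicalPhysics.QuantumManyBody.BoseGas.periodicGroundStateEnergy v N (Literature.MathematicalPhysics.QuantumManyBody.BoseGas.sideLength ρ N) + δ → ENNReal.ofReal (c * N) ≤ Literature.MathematicalPhysics.QuantumManyBody.BoseGas.condensateOccupation N (Literature.MathematicalPhysics.QuantumManyBody.BoseGas.sideLength ρ N) Ψ.ψ) → ∃ ρ₀ : ℝ, 0 < ρ₀ ∧ ∀ ρ : ℝ, 0 < ρ → ρ < ρ₀ → ∃ c :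 ℝ, 0 < c ∧ ∀ᶠ N : ℕ in Filter.atTop, ∃ δ : ENNReal, 0 < δ ∧ ∀ Ψ : Literature.MathematicalPhysics.QuantumManyBody.BoseGas.TrialState N (Literature.MathematicalPhysics.QuantumManyBody.BoseGas.sideLength ρ N), Literature.MathematicalPhysics.QuantumManyBody.BoseGas.energy v Ψ ≤ Literature.MathematicalPhysics.QuantumManyBody.BoseGas.groundStateEnergy v N (Literature.MathematicalPhysics.QuantumManyBody.BoseGas.sideLength ρ N) + δ → ENNReal.ofReal (c * N) ≤ Literature.MathematicalPhysics.QuantumManyBody.BoseGas.occupation N ((Literature.MathematicalPhysics.QuantumManyBody.BoseGas.box (Literature.MathematicalPhysics.QuantumManyBody.BoseGas.sideLength ρ N)).indicator fun _ => ((Real.sqrt (Literature.MathematicalPhysics.QuantumManyBody.BoseGas.sideLength ρ N ^ 3))⁻¹ : ℂ)) Ψ.ψ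

/-- item stmt-AtomisticToContinuum-7069 · support · rank 9 · closed · moot by None · by planner
[support] CramerRaoBragg (card cramer-rao-no-dilute-solid, item N1; filed by its plancard planner as
provable-now support — not load-bearing for this route's Assembly; refuter currency for density-wave
witnesses against PeriodicBEC). For EVERY periodic C¹ trial state Ψ of N particles on the torus of
side L > 0 and every lattice wavevector k = (2π/L)n, n ∈ ℤ³: |k|²(S(k) − 1)²/(4S(k)) ≤ T, where T =
∫_cell |∇Ψ|² (kineticDensity) and S(k) = N⁻¹∫_cell |Σ_j e^{ik·x_j}|²|Ψ|² is the static structure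
factor (real, via toReal; n = 0 and N = 0 are trivial by 1/0 = 0). Proof (four lines, no spectral
theory, Bose symmetry unused): P := |Ψ|² is C¹ and periodic, ∇P = 2Re(Ψ̄∇Ψ); Z := |Σ_j
e^{ik·x_j}|²/N is smooth and periodic (lattice k) with the EXACT identities ΔZ = −2|k|²(Z − 1) (each
Δ_m hits the two off-diagonal families) and |∇Z|² ≤ 4|k|²Z; integrate by parts on the torus (no
boundary terms): −2|k|²(S − 1) = ∫ΔZ·P = −∫∇Z·2Re(Ψ̄∇Ψ), so by Cauchy–Schwarz 4|k|⁴(S − 1)² ≤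
4(∫|∇Z|²P)(∫|∇Ψ|²) ≤ 16|k|²S·T (Cramér–Rao for the collective statistic Z against the Fisher
information I(P) ≤ 4T). Saturated up to constants by a modulated condensate ∏(1 + η cos k·x_j); the
ideal gas (S ≡ 1) pays nothing. C -/
@[route_item "route-AtomisticToContinuum-BECPeriodicReduction"]
def CramerRaoBragg : Prop :=
  ∀ (N : ℕ) (L : ℝ), 0 < L → ∀ (Ψ : Literature.MathematicalPhysics.QuantumManyBody.BoseGas.PeriodicTrialState N L) (n : Fin 3 → ℤ), let S : ℝ := (∫⁻ X in Literature.MathematicalPhysics.QuantumManyBody.BoseGas.cellN N L, (‖∑ j : Fin N, Complex.exp (Complex.I * ↑(2 * Real.pi / L * ∑ i : Fin 3, (n i : ℝ) * X j i))‖₊ : ENNReal) ^ 2 * (‖Ψ.ψ X‖₊ : ENNReal) ^ 2).toReal / N; ENNReal.ofReal ((2 * Real.pi / L) ^ 2 * (∑ i : Fin 3, (n i : ℝ) ^ 2) * (S - 1) ^ 2 / (4 * S)) ≤ ∫⁻ X in Literature.MathematicalPhysics.QuantumManyBody.BoseGas.cellN N L, Literature.MathematicalPhysics.QuantumManyBody.BoseGas.kineticDensity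 Ψ.ψ X

/-- item stmt-AtomisticToContinuum-7078 · support · rank 9 · closed · moot by None · by planner
[support] NoDiluteSolid (card cramer-rao-no-dilute-solid, item N2; negative knowledge about exactly
the near-minimisers PeriodicBEC quantifies over; rests only on CramerRaoBragg + the PROVED fact
Literature.MathematicalPhysics.QuantumManyBody.BoseGas.LSSY2005_upperBound_periodic_holds; not
load-bearing for the Assembly). For every repulsive finite-range v with scatteringLength v = a ≠ ⊤
there are C > 0 and ρ₀ > 0 such that for 0 < ρ < ρ₀, all large N, L = (N/ρ)^{1/3}, and EVERY
periodic trial state Ψ with periodicEnergy v Ψ ≤ E₀^per(N,L) + ρaN (a slack of the order of E₀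
itself, so no δ-after-N is needed): for every k = (2π/L)n, n ∈ ℤ³∖{0}, N·S(k) = ∫_cell|Σ_j
e^{ik·x_j}|²|Ψ|² ≤ 2N + C·ρa·N²·L²/|n|², i.e. BRAGG FRACTION S(k)/N ≤ 2/N + C′ρa/|k|² = 2/N +
O((|k|ξ)⁻²), ξ = (8πρa)^{-1/2}. At the crystal scale |k| = 2πρ^{1/3} this is O((ρa³)^{1/3}): an
extensive Bragg peak with period shorter than ~ξ — any quantum solid or cluster crystal at the
interparticle scale — is impossible for dilute near-ground states, uniformly in N, hard cores
included. Proof: CramerRaoBragg gives N·S ≤ 2N + 16N·T/|k|²; v ≥ 0 gives T ≤ periodicEnergy v Ψ ≤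
E₀^per + ρaN; LSSY2005 Thm 2.2 (2.14) (proved in tree) -/
@[route_item "route-AtomisticToContinuum-BECPeriodicReduction"]
def NoDiluteSolid : Prop :=
  ∀ v : ℝ → ENNReal, Literature.MathematicalPhysics.QuantumManyBody.BoseGas.IsRepulsiveFiniteRange v → Literature.MathematicalPhysics.QuantumManyBody.BoseGas.scatteringLength v ≠ ⊤ → ∃ C : ℝ, 0 < C ∧ ∃ ρ₀ : ℝ, 0 < ρ₀ ∧ ∀ ρ : ℝ, 0 < ρ → ρ < ρ₀ → ∀ᶠ N : ℕ in Filter.atTop, ∀ Ψ : Literature.MathematicalPhysics.QuantumManyBody.BoseGas.PeriodicTrialState N (Literature.MathematicalPhysics.QuantumManyBody.BoseGas.sideLength ρ N), Literature.MathematicalPhysics.QuantumManyBody.BoseGas.periodicEnergy v Ψ ≤ Literature.MathematicalPhysics.QuantumManyBody.BoseGas.periodicGroundStateEnergy v N (Literature.MathematicalPhysics.QuantumManyBody.BoseGas.sideLength ρ N) + ENNReal.ofReal (ρ * (Literature.MathematicalPhysics.QuantumManyBody.BoseGas.scatteringLength v).toReal * N) → ∀ n : Fin 3 → ℤ, n ≠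 0 → (∫⁻ X in Literature.MathematicalPhysics.QuantumManyBody.BoseGas.cellN N (Literature.MathematicalPhysics.QuantumManyBody.BoseGas.sideLength ρ N), (‖∑ j : Fin N, Complex.exp (Complex.I * ↑(2 * Real.pi / Literature.MathematicalPhysics.QuantumManyBody.BoseGas.sideLength ρ N * ∑ i : Fin 3, (n i : ℝ) * X j i))‖₊ : ENNReal) ^ 2 * (‖Ψ.ψ X‖₊ : ENNReal) ^ 2) ≤ ENNReal.ofReal (2 * N + C * ρ * (Literature.MathematicalPhysics.QuantumManyBody.BoseGas.scatteringLength v).toReal * (N : ℝ) ^ 2 * Literature.MathematicalPhysics.QuantumManyBody.BoseGas.sideLength ρ N ^ 2 / (∑ i : Fin 3, (n i : ℝ) ^ 2))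

/-- item stmt-AtomisticToContinuum-0829 · assembly · rank 1 · closed · moot by None · by planner
[assembly] PeriodicBEC → BoundaryTransferWeak → BoseEinsteinCondensation (both hypotheses inlined;
term proof: fun h1 h2 v hv => h2 v hv (h1 v hv)). -/
@[route_item "route-AtomisticToContinuum-BECPeriodicReduction"]
def Assembly : Prop :=
  (∀ v : ℝ → ENNReal, Literature.MathematicalPhysics.QuantumManyBody.BoseGas.IsRepulsiveFiniteRange v → ∃ ρ₀ : ℝ, 0 < ρ₀ ∧ ∀ ρ : ℝ, 0 < ρ → ρ < ρ₀ → ∃ c : ℝ, 0 < c ∧ ∀ᶠ N : ℕ in Filter.atTop, ∃ δ : ENNReal, 0 < δ ∧ ∀ Ψ : Literature.MathematicalPhysics.QuantumManyBody.BoseGas.PeriodicTrialState N (Literature.MathematicalPhysics.QuantumManyBody.BoseGas.sideLength ρ N), Literature.MathematicalPhysics.QuantumManyBody.BoseGas.periodicEnergy v Ψ ≤ Literature.MathematicalPhysics.QuantumManyBody.BoseGas.periodicGroundStateEnergy v N (Literature.MathematicalPhysics.QuantumManyBody.BoseGas.sideLength ρ N) + δ → ENNReal.ofReal (c * N) ≤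 Literature.MathematicalPhysics.QuantumManyBody.BoseGas.condensateOccupation N (Literature.MathematicalPhysics.QuantumManyBody.BoseGas.sideLength ρ N) Ψ.ψ) → (∀ v : ℝ → ENNReal, Literature.MathematicalPhysics.QuantumManyBody.BoseGas.IsRepulsiveFiniteRange v → (∃ ρ₀ : ℝ, 0 < ρ₀ ∧ ∀ ρ : ℝ, 0 < ρ → ρ < ρ₀ → ∃ c : ℝ, 0 < c ∧ ∀ᶠ N : ℕ in Filter.atTop, ∃ δ : ENNReal, 0 < δ ∧ ∀ Ψ : Literature.MathematicalPhysics.QuantumManyBody.BoseGas.PeriodicTrialState N (Literature.MathematicalPhysics.QuantumManyBody.BoseGas.sideLength ρ N), Literature.MathematicalPhysics.QuantumManyBody.BoseGas.periodicEnergy v Ψ ≤ Literature.MathematicalPhysics.QuantumManyBody.BoseGas.periodicGroundStateEnergy v N (Literature.MathematicalPhysics.QuantumManyBody.BoseGas.sideLength ρ N) + δ → ENNReal.ofReal (c * N) ≤ Literature.MathematicalPhysics.QuantumManyBody.BoseGas.condensateOccupation N (Literature.MathematicalPhysics.QuantumManyBody.BoseGas.sideLength ρ N) Ψ.ψ) →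 ∃ ρ₀ : ℝ, 0 < ρ₀ ∧ ∀ ρ : ℝ, 0 < ρ → ρ < ρ₀ → Literature.MathematicalPhysics.QuantumManyBody.BoseGas.HasGroundStateBEC v ρ) → Literature.MathematicalPhysics.QuantumManyBody.BoseGas.BoseEinsteinCondensation

end Summit.AtomisticToContinuum.BoseEinsteinCondensation.Theses.BECPeriodicReduction
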